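import Summits.ResolutionOfSingularities.ResolutionOfSingularities.Theorems.PurelyInseparableDim4CoordinateSNC
import Summits.ResolutionOfSingularities.ResolutionOfSingularities.Theorems.PurelyInseparableDim4ChartBoundary
import Literature.AlgebraicGeometry.Resolution.BlowupRestrictOpen
import HarnessLib

/-!
# Purely inseparable four-folds `z^p + F(x₁, …, x₄)`: TRANSLATED coordinate hyperplanes `V(xᵢ + cᵢ)` have simple
# normal crossings with every coordinate centre through them; their strict transforms on the charts
# (brick TY-2 (h) part 7a of cell `res-dim4-pi`; towards retiring the FC-1 input on the chart chain)

[OURS · counted 0] (D-0157 DOOR 2; director-resolution DR-157-C; desk caveat FC-1 «boundary amnesia»). Along the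
coordinate-centre walk the old exceptional hyperplanes read, on the re-centred charts, TRANSLATED coordinate
hyperplanes `V(xᵢ + cᵢ)` (`PurelyInseparableDim4ChartBoundary.lean`: `V(xᵢ) ↦ V(xᵢ + bᵢ)`). The presented state
remembers only those through the current origin (`cᵢ = 0`); the others still have to be simple normal crossings
with the next centre wherever they meet it. PROVED here (no `sorry`, no new axiom):

* **`hasSNCWith_translatedHyperplanes_𝓘Λ`** — on `𝔸ⁿ⁺¹_K`, for every list `l` of coordinates, every vector
  of constants `c` VANISHING ON `Λ`, the hyperplanes `V(xᵢ + cᵢ)`, `i ∈ l`, have simple normal crossings with the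
  coordinate subspace `V(xᵢ : i ∈ Λ)` — transport of `hasSNCWith_coordHyperplanes_𝓘Λ` along the translation
  automorphism `xᵢ ↦ xᵢ + cᵢ` (`AffinePointBlowup.translateEquiv`; `HasSNCWith.comap_of_isOpenImmersion`), which
  fixes the centre;
* `comap_translate_𝓘Λ`, `comap_translate_hyperplane` — the translation on the two kinds of sheaves;
* `strictTransformIdeal_specMap_subst_translate` / **`comap_translate_hyperplane_chart`** — the strict transform
  of a TRANSLATED hyperplane `V(xᵢ + c)` with `i ∉ S` (transversal to the centre `V(z, x_S)`) under ANY blowing up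
  along `V(z, x_S)`, read on the re-centred `x_j`-chart (`Θ xᵢ = xᵢ + bᵢ`), is `V(xᵢ + (c + bᵢ))` (the chart
  substitution fixes `xᵢ`, `x_j ∤ xᵢ + c`).

Nothing here is a statement about resolution of singularities in dimension ≥ 4 / characteristic `p` (NOT proved
anywhere in this programme). bears_on: LADDER-RESOLUTION:D157-DOOR2 (res-dim4-pi). Supports
stmt-ResolutionOfSingularities-16155 (helper, TY-2 (h)).
-/

-- every declaration of this summit lives under `Summit.ResolutionOfSingularities.ResolutionOfSingularities`
-- (summit = problem), which the duplicate-namespace linter flags; house convention (cf. the Target file).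
set_option linter.dupNamespace false

noncomputable section

open MvPolynomial Finset CategoryTheory AlgebraicGeometry Opposite TopologicalSpace
open AlgebraicGeometry.Scheme.IdealSheafData (ofIdealTop vanishingIdeal)

namespace Summit.ResolutionOfSingularities.ResolutionOfSingularities.Theorems.PIDim4

open Literature.AlgebraicGeometry.Resolution
open Literature.AlgebraicGeometry.Resolution.AffinePointBlowup (P A γ coord Wtop)

namespace ChartDictionary

/-! ## §1 Translated coordinate hyperplanes and a coordinate centre -/

section Translated

variable {n : ℕ} {K : Type} [Field K]

/-- The translation `xᵢ ↦ xᵢ + cᵢ` fixes the ideal sheaf of `V(x_Λ)` when `c` vanishes on `Λ`. -/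
theorem comap_translate_𝓘Λ (c : Fin (n + 1) → K) (Λ : Set (Fin (n + 1))) (hc : ∀ i ∈ Λ, c i = 0) :
    (AffineCoordBlowup.𝓘Λ n K Λ).comap
        (Spec.map (CommRingCat.ofHom (AffinePointBlowup.translateEquiv c : A n K →+* A n K))) =
      AffineCoordBlowup.𝓘Λ n K Λ := by
  rw [𝓘Λ_eq_ofIdealTop, comap_ofIdealTop_of_isAffine, Ideal.map_span, ← Set.image_comp]
  congr 2
  refine Set.image_congr fun i hi => ?_
  rw [Function.comp_apply, show coord n K i = (γ n K).symm (X i) from rfl, appTop_specMap_γ_symm,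
    show (AffinePointBlowup.translateEquiv c : A n K →+* A n K) (X i) = AffinePointBlowup.translateEquiv c (X i)
      from rfl, AffinePointBlowup.translateEquiv_X, hc i hi, C_0, add_zero]

/-- The translation carries the coordinate hyperplane sheaf `V(xᵢ)` to `V(xᵢ + cᵢ)`. -/
theorem comap_translate_hyperplane (c : Fin (n + 1) → K) (i : Fin (n + 1)) :
    (ofIdealTop (Ideal.span {coord n K i})).comap
        (Spec.map (CommRingCat.ofHom (AffinePointBlowup.translateEquiv c : A n K →+* A n K))) =
      ofIdealTop (Ideal.span {(γ n K).symm (X i + C (c i))}) := by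
  rw [show coord n K i = (γ n K).symm (X i) from rfl, comap_ofIdealTop_span_γ_symm]
  change ofIdealTop (Ideal.span {(γ n K).symm (AffinePointBlowup.translateEquiv c (X i))}) = _
  rw [AffinePointBlowup.translateEquiv_X]

/-- **TRANSLATED COORDINATE HYPERPLANES HAVE SIMPLE NORMAL CROSSINGS WITH A COORDINATE CENTRE** through them:
for every list `l` of coordinates and constants `c` with `cᵢ = 0` for `i ∈ Λ`, the hyperplanes `V(xᵢ + cᵢ)`,
`i ∈ l`, and the centre `V(xᵢ : i ∈ Λ)` satisfy `HasSNCWith` on `𝔸ⁿ⁺¹_K` (BGMW Def. 3.1.1 / 3.1.3 (2)). -/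
theorem hasSNCWith_translatedHyperplanes_𝓘Λ (l : List (Fin (n + 1))) (c : Fin (n + 1) → K)
    (Λ : Set (Fin (n + 1))) (hc : ∀ i ∈ Λ, c i = 0) :
    HasSNCWith (l.map fun i => ofIdealTop (Ideal.span {(γ n K).symm (X i + C (c i))}))
      (AffineCoordBlowup.𝓘Λ n K Λ) := by
  haveI : IsIso (CommRingCat.ofHom (AffinePointBlowup.translateEquiv c : A n K →+* A n K)) :=
    (inferInstance : IsIso (AffinePointBlowup.translateEquiv c).toRingEquiv.toCommRingCatIso.hom)
  have h := (hasSNCWith_coordHyperplanes_𝓘Λ (K := K) l Λ).comap_of_isOpenImmersion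
    (Spec.map (CommRingCat.ofHom (AffinePointBlowup.translateEquiv c : A n K →+* A n K)))
  rw [comap_translate_𝓘Λ c Λ hc, List.map_map] at h
  convert h using 2
  funext i
  exact (comap_translate_hyperplane c i).symm

end Translated

/-! ## §2 Strict transform of a translated hyperplane transversal to the centre, on the charts -/

section Transversal

variable {K : Type} [Field K] {S : Finset (Fin 4)} {j : Fin 4} {W : Scheme.{0}} {π : W ⟶ P 4 K}

/-- `x_j ∤ xᵢ + c` in `Γ(𝔸⁵, ⊤)` for `i ≠ j` (any constant `c`). -/
theorem not_coord_dvd_translate {i : Fin 4} (hij : i ≠ j) (c : K) :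
    ¬ coord 4 K j.succ ∣ (γ 4 K).symm (X i.succ + C c) := by
  rintro ⟨q, hq⟩
  have h := congrArg (γ 4 K) hq
  rw [RingEquiv.apply_symm_apply, map_mul, AffinePointBlowup.γ_coord] at h
  have h1 : coeff (Finsupp.single i.succ 1) (X i.succ + C c : A 4 K) = 1 := by
    rw [coeff_add, coeff_X, if_pos rfl, coeff_C, if_neg (Finsupp.single_ne_zero.mpr one_ne_zero).symm, add_zero]
  have h2 : coeff (Finsupp.single i.succ 1) (X j.succ * γ 4 K q : A 4 K) = 0 := by
    rw [coeff_X_mul', if_neg]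
    rw [Finsupp.mem_support_iff, Finsupp.single_apply, if_neg (fun h => hij (Fin.succ_inj.mp h))]
    exact fun h => h rfl
  rw [h, h2] at h1
  exact zero_ne_one h1

/-- **Strict transform of a translated hyperplane transversal to the centre, along the chart substitution**:
for `i ∉ S` (so `ψ(xᵢ) = xᵢ`) and any `c`, `⋃ₙ ((xᵢ + c)·𝒪 : (x_j)ⁿ) = (xᵢ + c)·𝒪`. -/
theorem strictTransformIdeal_specMap_subst_translate (hj : j ∈ S) {i : Fin 4} (hi : i ∉ S) (c : K) :
    strictTransformIdeal
        (Spec.map (CommRingCat.ofHom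
          (coordBlowupSubst K (insert 0 (Fin.succ '' (S : Set (Fin 4)))) j.succ).toRingHom))
        (AffineCoordBlowup.𝓘Λ 4 K (insert 0 (Fin.succ '' (S : Set (Fin 4)))))
        (ofIdealTop (Ideal.span {(γ 4 K).symm (X i.succ + C c)})) =
      ofIdealTop (Ideal.span {(γ 4 K).symm (X i.succ + C c)}) := by
  have hij : i ≠ j := fun h => hi (h ▸ hj)
  have hψ : coordBlowupSubst K (insert 0 (Fin.succ '' (S : Set (Fin 4)))) j.succ (X i.succ + C c) = X i.succ + C c := by
    rw [map_add, coordBlowupSubst_C,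
      coordBlowupSubst_X_of_not_mem K _ j.succ (fun h => hi ((succ_mem_centreVars_iff S i).mp h))]
  rw [strictTransformIdeal, comap_𝓘Λ_specMap_subst (succ_mem_centreVars hj), comap_ofIdealTop_span_γ_symm]
  change ⨆ m : ℕ, colon (ofIdealTop (Ideal.span {(γ 4 K).symm (coordBlowupSubst K _ j.succ (X i.succ + C c))}))
      (ofIdealTop (Ideal.span {coord 4 K j.succ}) ^ m) = _
  rw [hψ, show (γ 4 K).symm (X i.succ + C c) = coord 4 K j.succ ^ 0 * (γ 4 K).symm (X i.succ + C c) by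
    rw [pow_zero, one_mul]]
  simp_rw [← ofIdealTop_pow, colon_ofIdealTop]
  rw [← ofIdealTop_iSup, iSup_colon_span_pow_mul_eq (prime_coord j.succ) (not_coord_dvd_translate hij c), pow_zero,
    one_mul]

/-- **TRANSLATED BOUNDARY DICTIONARY.** For ANY blowing up `π` of `𝔸⁵_K` along `V(z, x_S)`, `j ∈ S`, `i ∉ S` and a
re-centring `Θ` with `Θ xᵢ = xᵢ + bᵢ`: the strict transform of the translated hyperplane `V(xᵢ + c)` reads
`V(xᵢ + (c + bᵢ))` on the re-centred `x_j`-chart `Spec Θ ≫ chartImm`. -/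
theorem comap_translate_hyperplane_chart (hj : j ∈ S) {i : Fin 4} (hi : i ∉ S) (c : K) {Θ : A 4 K →+* A 4 K}
    {b : Fin 4 → K} (hΘ : Θ (X i.succ) = X i.succ + C (b i)) (hΘC : ∀ r : K, Θ (C r) = C r)
    (hπ : IsBlowup π (AffineCoordBlowup.𝓘Λ 4 K (insert 0 (Fin.succ '' (S : Set (Fin 4)))))) :
    (strictTransformIdeal π (AffineCoordBlowup.𝓘Λ 4 K (insert 0 (Fin.succ '' (S : Set (Fin 4)))))
        (ofIdealTop (Ideal.span {(γ 4 K).symm (X i.succ + C c)}))).comap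
        (Spec.map (CommRingCat.ofHom Θ) ≫ AffineCoordBlowup.chartImm hπ (succ_mem_centreVars hj)) =
      ofIdealTop (Ideal.span {(γ 4 K).symm (X i.succ + C (c + b i))}) := by
  haveI : IsProper π := hπ.isProper
  haveI : IsLocallyNoetherian W := LocallyOfFiniteType.isLocallyNoetherian π
  have hsq : AffineCoordBlowup.chartImm hπ (succ_mem_centreVars hj) ≫ π =
      Spec.map (CommRingCat.ofHom
        (coordBlowupSubst K (insert 0 (Fin.succ '' (S : Set (Fin 4)))) j.succ).toRingHom) ≫ 𝟙 (P 4 K) := by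
    rw [Category.comp_id]
    exact AffineCoordBlowup.chartImm_comp hπ (succ_mem_centreVars hj)
  have hΘ' : Θ (X i.succ + C c) = X i.succ + C (c + b i) := by
    rw [map_add, hΘ, hΘC, map_add, add_assoc, add_comm (C (b i))]
  rw [Scheme.IdealSheafData.comap_comp, comap_strictTransformIdeal_of_flat (t := 𝟙 (P 4 K)) hsq,
    Scheme.IdealSheafData.comap_id, Scheme.IdealSheafData.comap_id,
    strictTransformIdeal_specMap_subst_translate hj hi c, comap_ofIdealTop_span_γ_symm, hΘ']

end Transversal

end ChartDictionary

end Summit.ResolutionOfSingularities.ResolutionOfSingularities.Theorems.PIDim4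

end
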